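import Literature.NumberTheory.Automorphic.HarrisLanTaylorThorneThm713Proofs
import HarnessLib

/-!
# Varma 2024, §9: the group-theoretic engine of the proof of Thm. 9.2 — HLTT's Prop. 7.12 applied
# to the Frobenii AND to the Frobenius-power (Weil) elements at additional places

Topic `Literature/NumberTheory/Automorphic`; a PROOFS file (theorems only: no definition, no named
fact — D-0014/D-0026), sibling of `HarrisLanTaylorThorneThm713Proofs`, whose engine
`theorem713_of_goodPlaces` (Harris–Lan–Taylor–Thorne 2016, proof of Thm. 7.13, p. 232: Prop. 7.12
for `Γ = Γ_{K,S}`, `μ = ε_p^{-2}`, `𝔉` = the Frobenii outside `S`) it generalises in exactly the way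
Varma's proof of her Thm. 9.2 generalises HLTT's proof of Thm. 7.13.

I. Varma, *Local–global compatibility for regular algebraic cuspidal automorphic representations
when `ℓ ≠ p`*, Forum Math. Sigma 12 (2024) e21 (= arXiv:1411.2520v1), proof of Thm. 9.2 (journal
p. 31; = arXiv proof of Thm. 10.2, p. 24), verbatim (arXiv): "Let `Γ = G_{F,S}` and `k = ℚ̄_p`,
and `μ = ε_p^{-2}`, and `ℳ` consisting of all sufficiently large integers `m`, and
`ρ_m = R_{p,ı}(π, m)` … Let `𝔉` contain all elements `σ_v ∈ W_{F_v}` which projects to a power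
of Frobenius under the map `W_{F_v} → Gal(\bar k(v)/k(v))` … Define `𝓔¹_{σ_v}` to be the
multiset of roots of the characteristic polynomial `ı⁻¹rec_{F_v}(π_v|det|_v^{(1-n)/2})(σ_v)` and
`𝓔²_{σ_v}` equal to the multiset of roots of the characteristic polynomial of
`ı⁻¹rec_{F_{ᶜv}}(π_{ᶜv}|det|^{(-1+3n)/2})(σ_{ᶜv}⁻¹)`. We can then conclude [by Prop. 9.1 = HLTT
Prop. 7.12] `(r_{p,ı}(π)|_{W_{F_v}})^{ss} ≅ ı⁻¹ rec_{F_v}(π_v|det|_v^{(1-n)/2})`" — (9.1) of the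
journal, p. 31.

So where HLTT feed Prop. 7.12 with Frobenius elements only (at the places where the
`2n`-dimensional `R_{p,ı}(π, N)` are unramified), Varma feeds it ALSO with the elements of `Γ_K`
lying in a decomposition group `D_𝔓`, `𝔓 ∣ v`, and acting on the residue field as a NON-ZERO
power `Frob^d` of the arithmetic Frobenius — in the tree: `σ (φ^d)⁻¹ ∈ I_𝔓` for an arithmetic
Frobenius `φ` at `𝔓` (`IsArithFrobAt`) and `d ∈ ℤ ∖ {0}`, the rendering already used in
`VarmaUnramifiedWeilTracesProofs` — at places `v ∤ p` where the `ρ_m` may be RAMIFIED, with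
`𝓔¹_σ` = the `d`-th powers of the predicted Frobenius eigenvalues (for unramified `π_v`: of the
roots of `arithFrobPolyOfSatake ı q_v n α`), `𝓔²_σ` another `n`-element multiset of non-zero
elements, and the twist `μ(σ)^m = ε_p(σ)^{-2m} = q_v^{-2dm}` (the cyclotomic character is
unramified at `v ∤ p` with `ε_p(Frob_v) = q_v`).  The output `ρ¹ = r` then has
`roots (charpoly r(σ)) = 𝓔¹_σ` at those elements too — the trace identity `tr r(σ) = ∑_j b_j^d` of
(9.1) at an unramified `π_v` on the elements of non-zero degree; traces, the degree `d = 0` and the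
assembly with the inputs of Thm. 9.2 are in the sibling `VarmaTheorem92TracesProofs`.

## Main statements (all proved)

* `Varma2024.cyclotomicCharacter_eq_one_of_mem_inertia`,
  `Varma2024.cyclotomicCharacter_eq_zpow_of_mul_zpow_inv_mem_inertia`,
  `Varma2024.coe_muS_mk_of_frobPow`, `Varma2024.coe_muS_mk_zpow_of_frobPow`,
  `Varma2024.not_isOfFinOrder_muS_mk_of_frobPow` — the character `μ = ε_p^{-2}` of `Γ_{K,S}`
  (`muS`) at a Frobenius-power element of degree `d` at `v ∤ p`: `μ(σ) = q_v^{-2d}`, of infinite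
  order when `d ≠ 0` (from the discharged `FramedGaloisRep.isUnramifiedAt_cyclotomic_holds` and
  `GaloisRep.cyclotomicCharacter_apply_of_isArithFrobAt`).
* `Varma2024.theorem92_engine` — **the engine**: the hypotheses of `theorem713_of_goodPlaces`
  (finite `S`; `R_N`, `N ≥ N₀`, continuous semisimple `2n`-dimensional, unramified outside `S`
  with the Cor. 6.27-shaped Frobenius characteristic polynomials there) PLUS, on a set `T` of
  places `v ∤ p` with `π_v` unramified (inside `S` or not), the Varma-shaped hypothesis at the
  Frobenius-power elements of non-zero degree (roots of `charpoly R_N(σ)` =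
  `{b_j^d} ⊔ 𝓔²_σ · q_v^{-2dN}`); conclusion: a continuous semisimple `r : Γ_K → GL_n(ℚ̄_p)`,
  unramified outside `S` with Frobenius characteristic polynomial `arithFrobPolyOfSatake ı q_v n α`
  there (HLTT), AND with `roots (charpoly r(σ)) = {b_j^d}` at every Frobenius-power element of
  non-zero degree at the places of `T` (Varma).  Proof: Prop. 7.12 (`prop712Hausdorff`, a
  hypothesis as in the HLTT engine — discharged in the tree as `prop712Hausdorff_holds`) on
  `Γ_{K,S}` with the dense set `𝔉` = images of the Frobenii outside `S` (dense by Chebotarev,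
  `GammaS.dense_frob`) and of the Frobenius-power elements at `T`; the two root multisets of each
  `f ∈ 𝔉` are CHOSEN among those of its witnesses, and the conclusion at every witness of `f`
  follows from the uniqueness of twisted-sum decompositions (HLTT Cor. 7.3, `twistedSum_unique`),
  as in `theorem713_of_goodPlaces`.

## References

* I. Varma, Forum Math. Sigma 12 (2024) e21, doi:10.1017/fms.2024.7: Prop. 9.1, Thm. 9.2 and its
  proof with (9.1) (pp. 30–31); = arXiv:1411.2520v1, Prop. 10.1 and proof of Thm. 10.2 (p. 24).
  [VarmaFMS2024]
* M. Harris, K.-W. Lan, R. Taylor, J. Thorne, Res. Math. Sci. 3:37 (2016): Cor. 7.3 (pp. 227–228),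
  Prop. 7.12 and the proof of Thm. 7.13 (p. 232). [HarrisLanTaylorThorneRMS2016]
* J.-P. Serre, *Abelian ℓ-adic representations and elliptic curves* (1968), Ch. I §1.2 (the
  cyclotomic character: unramified away from `p`, `χ_p(Frob_v) = N v`). [SerreAbelianLadic1968]
-/

noncomputable section

open scoped MatrixGroups Matrix Classical Polynomial NumberField
open NumberField IsDedekindDomain Field Polynomial Literature.NumberTheory.Automorphic

namespace Literature.NumberTheory.Automorphic

namespace Varma2024

open Literature.NumberTheory.GaloisRepresentations

/-! ### `μ = ε_p^{-2}` at the Frobenius-power elements -/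

section Mu

variable (p : ℕ) [Fact p.Prime] {K : Type} [Field K] [NumberField K]

/-- **The cyclotomic character is trivial on inertia away from `p`**: for `v ∤ p`, `𝔓 ∣ v` and
`σ ∈ I_𝔓`, `ε_p(σ) = 1` (the discharged `FramedGaloisRep.isUnramifiedAt_cyclotomic_holds`, read
through `FramedGaloisRep.det_cyclotomic_apply`).
[cite: SerreAbelianLadic1968, Ch. I §1.2 (Example: the cyclotomic character)] -/
theorem cyclotomicCharacter_eq_one_of_mem_inertia {v : HeightOneSpectrum (𝓞 K)}
    (hv : ((p : ℕ) : 𝓞 K) ∉ v.asIdeal) {𝔓 : Ideal (absIntegers (𝓞 K) K)}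
    (h𝔓 : 𝔓 ∈ v.primesAbove) {σ : absoluteGaloisGroup K}
    (hσ : σ ∈ 𝔓.inertia (absoluteGaloisGroup K)) :
    GaloisRep.cyclotomicCharacter K p σ = 1 := by
  have h1 : (FramedGaloisRep.cyclotomic K p) σ = 1 :=
    FramedGaloisRep.isUnramifiedAt_cyclotomic_holds K p hv 𝔓 h𝔓 σ hσ
  rw [← FramedGaloisRep.det_cyclotomic_apply]
  change Matrix.GeneralLinearGroup.det ((FramedGaloisRep.cyclotomic K p) σ) = 1
  rw [h1, map_one]

/-- **`ε_p(σ) = ε_p(φ)^d` at a Frobenius-power element**: if `σ (φ^d)⁻¹ ∈ I_𝔓` with `𝔓 ∣ v`,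
`v ∤ p`, then `ε_p(σ) = ε_p(φ)^d`. [cite: SerreAbelianLadic1968, Ch. I §1.2] -/
theorem cyclotomicCharacter_eq_zpow_of_mul_zpow_inv_mem_inertia {v : HeightOneSpectrum (𝓞 K)}
    (hv : ((p : ℕ) : 𝓞 K) ∉ v.asIdeal) {𝔓 : Ideal (absIntegers (𝓞 K) K)}
    (h𝔓 : 𝔓 ∈ v.primesAbove) {σ φ : absoluteGaloisGroup K} {d : ℤ}
    (hσ : σ * (φ ^ d)⁻¹ ∈ 𝔓.inertia (absoluteGaloisGroup K)) :
    GaloisRep.cyclotomicCharacter K p σ = GaloisRep.cyclotomicCharacter K p φ ^ d := by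
  have h1 := cyclotomicCharacter_eq_one_of_mem_inertia p hv h𝔓 hσ
  rw [map_mul, map_inv, map_zpow, mul_inv_eq_one] at h1
  exact h1

variable (S : Set (HeightOneSpectrum (𝓞 K)))

/-- **`μ(σ) = q_v^{-2d}` at a Frobenius-power element of degree `d`**: for `S` avoiding the
places above `p` (`hS`), `v ∤ p` (in `S` or not), `𝔓 ∣ v`, `φ` an arithmetic Frobenius at `𝔓`
and `σ (φ^d)⁻¹ ∈ I_𝔓`, the character `μ = ε_p^{-2}` of `Γ_{K,S}` (`muS`) takes at the image of
`σ` the value `q_v^{-2d}` (`ε_p(φ) = q_v`, `GaloisRep.cyclotomicCharacter_apply_of_isArithFrobAt`).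
For `d = 1`, `σ = φ`, this is `coe_muS_mk_of_isArithFrobAt`.
[cite: SerreAbelianLadic1968, Ch. I §1.2 (Example: the cyclotomic character)] -/
theorem coe_muS_mk_of_frobPow (hS : ∀ v ∉ S, ((p : ℕ) : 𝓞 K) ∉ v.asIdeal)
    {v : HeightOneSpectrum (𝓞 K)} (hv : ((p : ℕ) : 𝓞 K) ∉ v.asIdeal)
    {𝔓 : Ideal (absIntegers (𝓞 K) K)} (h𝔓 : 𝔓 ∈ v.primesAbove)
    {σ φ : absoluteGaloisGroup K} (hφ : IsArithFrobAt (𝓞 K) φ 𝔓) {d : ℤ}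
    (hσ : σ * (φ ^ d)⁻¹ ∈ 𝔓.inertia (absoluteGaloisGroup K)) :
    ((muS p S hS (QuotientGroup.mk σ) : (PadicAlgCl p)ˣ) : PadicAlgCl p) =
      (v.residueCard : PadicAlgCl p) ^ (-(2 * d)) := by
  -- push the units of `ℤ_p` to units of `ℚ̄_p`
  set G : ℤ_[p]ˣ →* (PadicAlgCl p)ˣ :=
    Units.map (((algebraMap ℚ_[p] (PadicAlgCl p)).comp PadicInt.Coe.ringHom : ℤ_[p] →+* _) :
      ℤ_[p] →* PadicAlgCl p) with hG
  have hGval : ∀ u : ℤ_[p]ˣ, ((G u : (PadicAlgCl p)ˣ) : PadicAlgCl p) =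
      algebraMap ℚ_[p] (PadicAlgCl p) ((u : ℤ_[p]) : ℚ_[p]) := fun u ↦ rfl
  have hφq : ((G (GaloisRep.cyclotomicCharacter K p φ) : (PadicAlgCl p)ˣ) : PadicAlgCl p) =
      (v.residueCard : PadicAlgCl p) := by
    rw [hGval, GaloisRep.cyclotomicCharacter_apply_of_isArithFrobAt hv h𝔓 hφ,
      PadicInt.coe_natCast, map_natCast]
  rw [coe_muS_mk, ← hGval, cyclotomicCharacter_eq_zpow_of_mul_zpow_inv_mem_inertia p hv h𝔓 hσ,
    map_zpow, Units.val_zpow_eq_zpow_val, hφq, ← zpow_mul, mul_comm, neg_mul]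

/-- Integral powers: `μ(σ)^m = q_v^{-2dm}` at a Frobenius-power element of degree `d`.
[folklore] -/
theorem coe_muS_mk_zpow_of_frobPow (hS : ∀ v ∉ S, ((p : ℕ) : 𝓞 K) ∉ v.asIdeal)
    {v : HeightOneSpectrum (𝓞 K)} (hv : ((p : ℕ) : 𝓞 K) ∉ v.asIdeal)
    {𝔓 : Ideal (absIntegers (𝓞 K) K)} (h𝔓 : 𝔓 ∈ v.primesAbove)
    {σ φ : absoluteGaloisGroup K} (hφ : IsArithFrobAt (𝓞 K) φ 𝔓) {d : ℤ}
    (hσ : σ * (φ ^ d)⁻¹ ∈ 𝔓.inertia (absoluteGaloisGroup K)) (m : ℤ) :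
    (((muS p S hS (QuotientGroup.mk σ)) ^ m : (PadicAlgCl p)ˣ) : PadicAlgCl p) =
      (v.residueCard : PadicAlgCl p) ^ (-(2 * d * m)) := by
  rw [Units.val_zpow_eq_zpow_val, coe_muS_mk_of_frobPow p S hS hv h𝔓 hφ hσ, ← zpow_mul,
    neg_mul]

/-- **`μ(σ)` has infinite order** at a Frobenius-power element of NON-ZERO degree `d` (`q_v > 1`
is a natural number and `ℚ̄_p` has characteristic `0`): the hypothesis "`μ(f)` has infinite order
for all `f ∈ 𝔉`" of Prop. 7.12 / Prop. 9.1 at these elements. [folklore] -/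
theorem not_isOfFinOrder_muS_mk_of_frobPow (hS : ∀ v ∉ S, ((p : ℕ) : 𝓞 K) ∉ v.asIdeal)
    {v : HeightOneSpectrum (𝓞 K)} (hv : ((p : ℕ) : 𝓞 K) ∉ v.asIdeal)
    {𝔓 : Ideal (absIntegers (𝓞 K) K)} (h𝔓 : 𝔓 ∈ v.primesAbove)
    {σ φ : absoluteGaloisGroup K} (hφ : IsArithFrobAt (𝓞 K) φ 𝔓) {d : ℤ} (hd : d ≠ 0)
    (hσ : σ * (φ ^ d)⁻¹ ∈ 𝔓.inertia (absoluteGaloisGroup K)) :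
    ¬ IsOfFinOrder (muS p S hS (QuotientGroup.mk σ)) := by
  intro hfin
  obtain ⟨k, hk, hk1⟩ := hfin.exists_pow_eq_one
  have h := congrArg (fun u : (PadicAlgCl p)ˣ ↦ (u : PadicAlgCl p)) hk1
  simp only [Units.val_pow_eq_pow_val, Units.val_one,
    coe_muS_mk_of_frobPow p S hS hv h𝔓 hφ hσ] at h
  rw [← zpow_natCast, ← zpow_mul] at h
  -- `(q_v : ℚ̄_p) ^ e = 1` with `e = -(2d) k ≠ 0`: impossible as `q_v > 1` is a natural number
  have hq : (v.residueCard : PadicAlgCl p) = ((v.residueCard : ℚ) : PadicAlgCl p) := by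
    push_cast; rfl
  have he : (-(2 * d) * (k : ℤ)) ≠ 0 := by
    have : (k : ℤ) ≠ 0 := by exact_mod_cast hk.ne'
    exact mul_ne_zero (neg_ne_zero.mpr (mul_ne_zero two_ne_zero hd)) this
  rw [hq, ← Rat.cast_zpow, show (1 : PadicAlgCl p) = ((1 : ℚ) : PadicAlgCl p) by push_cast; rfl,
    Rat.cast_inj] at h
  have hq1 : (1 : ℚ) < (v.residueCard : ℚ) := by exact_mod_cast v.one_lt_residueCard
  rcases lt_or_gt_of_ne he with hneg | hpos
  · have : (v.residueCard : ℚ) ^ (-(2 * d) * (k : ℤ)) < 1 := zpow_lt_one_of_neg₀ hq1 hneg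
    exact this.ne h
  · have : 1 < (v.residueCard : ℚ) ^ (-(2 * d) * (k : ℤ)) := one_lt_zpow₀ hq1 hpos
    exact this.ne' h

end Mu

/-! ### The engine: Prop. 7.12 on `Γ_{K,S}` with Frobenii outside `S` and Frobenius-power
elements at the places of `T` -/

/-- **The group-theoretic engine of Varma's proof of Thm. 9.2** (journal p. 31 / arXiv proof of
Thm. 10.2, p. 24), generalising `theorem713_of_goodPlaces` (HLTT, proof of Thm. 7.13, p. 232).
Data as there: `K` a number field, `p` prime, `n > 0`, `π` an automorphic representation of
`GL_n(𝔸_K)`, `ı : ℚ̄_p ≃ ℂ`, a **finite** set `S` of finite places outside which `v ∤ p` and `π_v`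
is unramified, `N₀`, continuous `R_N : Γ_K → GL_{2n}(ℚ̄_p)` semisimple for `N ≥ N₀`, unramified
outside `S` with arithmetic-Frobenius characteristic polynomial
`arithFrobPolyOfSatake ı q_v n α · ∏_{b ∈ B_v}(X - b q_v^{-2N})` at `v ∉ S` (`B_v ∌ 0` of
cardinality `n`).  IN ADDITION (Varma): a set `T` of places `v ∤ p` and, for the elements
`σ ∈ Γ_K` with `σ (φ^d)⁻¹ ∈ I_𝔓` for some `𝔓 ∣ v`, `v ∈ T`, an arithmetic Frobenius `φ` at `𝔓`
and `d ≠ 0` ("the elements of `W_{F_v}` which project to a [non-zero] power of Frobenius"),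
`n`-element multisets `𝓔²` of non-zero elements (`E₂ v 𝔓 φ d σ`) such that for every Satake
parameter `α` of `π` at `v` and `N ≥ N₀` the roots of `charpoly R_N(σ)` are
`{b^d : b root of arithFrobPolyOfSatake ı q_v n α} ⊔ 𝓔² · q_v^{-2dN}`.  CONCLUSION: a continuous
semisimple `r : Γ_K → GL_n(ℚ̄_p)`, unramified outside `S` with Frobenius characteristic polynomial
`arithFrobPolyOfSatake ı q_v n α` at `v ∉ S` (HLTT's conclusion), AND with
`roots (charpoly r(σ)) = {b^d}` at every such Frobenius-power element at the places of `T`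
(Varma's (9.1) on the elements of non-zero degree).  Proof: Prop. 7.12 (`prop712Hausdorff`) for
`Γ = Γ_{K,S}` (`GammaS K S`), `k = ℚ̄_p`, `μ = ε_p^{-2}` (`muS`; `μ(Frob_v) = q_v^{-2}`,
`μ(σ) = q_v^{-2d}` at a Frobenius-power element, `coe_muS_mk_of_frobPow`, both of infinite order),
`𝔉` = the images of the Frobenii outside `S` (dense by Chebotarev, `GammaS.dense_frob`) and of the
Frobenius-power elements at `T`, `ℳ = [N₀, ∞)`, `ρ_m` = the descent of `R_m`; the two multisets of
each `f ∈ 𝔉` are chosen among its witnesses and the conclusion at every witness follows from the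
uniqueness of twisted-sum decompositions (HLTT Cor. 7.3, `twistedSum_unique`).
[cite: VarmaFMS2024, proof of Thm. 9.2 with (9.1) (p. 31); arXiv:1411.2520v1 proof of Thm. 10.2 (p. 24)]
[cite: HarrisLanTaylorThorneRMS2016, Prop. 7.12 and proof of Thm. 7.13 (p. 232)] -/
theorem theorem92_engine (h712 : HarrisLanTaylorThorne2016.prop712Hausdorff)
    (hC : Automorphic.chebotarev_artinRep) (hne : hasSatakeParamAt_ne_zero)
    {n : ℕ} {K : Type} [Field K] [NumberField K] {hcpt : isCompact_glFiniteIntegralLevel n K}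
    (p : ℕ) [Fact p.Prime] (hn : 0 < n) (π : AutomorphicRepData (AutomorphyDatum.gl n K hcpt))
    (ι : PadicAlgCl p ≃+* ℂ) {S : Set (HeightOneSpectrum (𝓞 K))} (hSfin : S.Finite)
    (hSp : ∀ v ∉ S, ((p : ℕ) : 𝓞 K) ∉ v.asIdeal)
    (hSat : ∀ v ∉ S, ∃ α : Multiset ℂ, π.HasSatakeParamAt v α)
    {N₀ : ℕ} {R : ℕ → FramedGaloisRep K (PadicAlgCl p) (2 * n)}
    {B : HeightOneSpectrum (𝓞 K) → Multiset (PadicAlgCl p)}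
    (hRss : ∀ N, N₀ ≤ N → (R N).toGaloisRep.IsSemisimple)
    (hB : ∀ v ∉ S, Multiset.card (B v) = n ∧ (0 : PadicAlgCl p) ∉ B v)
    (hRv : ∀ v ∉ S, ∀ N, N₀ ≤ N → (R N).IsUnramifiedAt v ∧
      ∀ α : Multiset ℂ, π.HasSatakeParamAt v α →
        (R N).HasFrobCharpolyAt v (arithFrobPolyOfSatake ι v.residueCard n α *
          ((B v).map fun b ↦ X - C (b * ((v.residueCard : PadicAlgCl p)⁻¹) ^ (2 * N))).prod))
    {T : Set (HeightOneSpectrum (𝓞 K))} (hTp : ∀ v ∈ T, ((p : ℕ) : 𝓞 K) ∉ v.asIdeal)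
    (hTsat : ∀ v ∈ T, ∃ α : Multiset ℂ, π.HasSatakeParamAt v α)
    {E₂ : HeightOneSpectrum (𝓞 K) → Ideal (absIntegers (𝓞 K) K) → absoluteGaloisGroup K → ℤ →
      absoluteGaloisGroup K → Multiset (PadicAlgCl p)}
    (hE₂ : ∀ v 𝔓 φ d σ, Multiset.card (E₂ v 𝔓 φ d σ) = n ∧ (0 : PadicAlgCl p) ∉ E₂ v 𝔓 φ d σ)
    (hRT : ∀ v ∈ T, ∀ α : Multiset ℂ, π.HasSatakeParamAt v α →
      ∀ 𝔓 ∈ v.primesAbove, ∀ φ : absoluteGaloisGroup K, IsArithFrobAt (𝓞 K) φ 𝔓 →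
      ∀ d : ℤ, d ≠ 0 → ∀ σ : absoluteGaloisGroup K,
        σ * (φ ^ d)⁻¹ ∈ 𝔓.inertia (absoluteGaloisGroup K) → ∀ N, N₀ ≤ N →
        (FramedRep.charpoly (R N) σ).roots =
          (arithFrobPolyOfSatake ι v.residueCard n α).roots.map (· ^ d) +
            (E₂ v 𝔓 φ d σ).map (· * (v.residueCard : PadicAlgCl p) ^ (-(2 * d * (N : ℤ))))) :
    ∃ r : FramedGaloisRep K (PadicAlgCl p) n, r.toGaloisRep.IsSemisimple ∧
      (∀ v ∉ S, r.IsUnramifiedAt v ∧ ∀ α : Multiset ℂ, π.HasSatakeParamAt v α →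
        r.HasFrobCharpolyAt v (arithFrobPolyOfSatake ι v.residueCard n α)) ∧
      (∀ v ∈ T, ∀ α : Multiset ℂ, π.HasSatakeParamAt v α →
        ∀ 𝔓 ∈ v.primesAbove, ∀ φ : absoluteGaloisGroup K, IsArithFrobAt (𝓞 K) φ 𝔓 →
        ∀ d : ℤ, d ≠ 0 → ∀ σ : absoluteGaloisGroup K,
          σ * (φ ^ d)⁻¹ ∈ 𝔓.inertia (absoluteGaloisGroup K) →
          (FramedRep.charpoly r σ).roots =
            (arithFrobPolyOfSatake ι v.residueCard n α).roots.map (· ^ d)) := by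
  classical
  have hRunr : ∀ N, N₀ ≤ N → ∀ v ∉ S, (R N).IsUnramifiedAt v :=
    fun N hN v hv ↦ (hRv v hv N hN).1
  -- `Γ = Γ_{K,S}`, the family `ρ_m`, the character `μ`
  let ρ : ℤ → FramedRep (GammaS K S) (PadicAlgCl p) (2 * n) := fun m ↦
    if hm : (N₀ : ℤ) ≤ m then (R m.toNat).descend (hRunr m.toNat (by omega))
    else (R N₀).descend (hRunr N₀ le_rfl)
  have hρ_of_le : ∀ {m : ℤ} (hm : (N₀ : ℤ) ≤ m),
      ρ m = (R m.toNat).descend (hRunr m.toNat (by omega)) := fun hm ↦ dif_pos hm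
  let μ : GammaS K S →ₜ* (PadicAlgCl p)ˣ := muS p S hSp
  -- the two kinds of elements: Frobenii outside `S`, Frobenius-power elements at `T`
  let AF : Set (absoluteGaloisGroup K) :=
    {σ | ∃ v ∉ S, ∃ 𝔓 ∈ v.primesAbove, IsArithFrobAt (𝓞 K) σ 𝔓}
  let AW : Set (absoluteGaloisGroup K) :=
    {σ | ∃ v ∈ T, ∃ 𝔓 ∈ v.primesAbove, ∃ φ : absoluteGaloisGroup K, IsArithFrobAt (𝓞 K) φ 𝔓 ∧
      ∃ d : ℤ, d ≠ 0 ∧ σ * (φ ^ d)⁻¹ ∈ 𝔓.inertia (absoluteGaloisGroup K)}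
  let 𝔉 : Set (GammaS K S) := QuotientGroup.mk '' (AF ∪ AW)
  have h𝔉F : QuotientGroup.mk '' AF ⊆ 𝔉 := Set.image_mono Set.subset_union_left
  have h𝔉 : Dense 𝔉 := (GammaS.dense_frob hC hSfin).mono h𝔉F
  -- the root multisets `E₁ v α` = roots of `arithFrobPolyOfSatake ı q_v n α`
  let E₁ : HeightOneSpectrum (𝓞 K) → Multiset ℂ → Multiset (PadicAlgCl p) := fun v α ↦
    (arithFrobPolyOfSatake ι v.residueCard n α).roots
  have hE₁ : ∀ {v : HeightOneSpectrum (𝓞 K)} {α : Multiset ℂ}, π.HasSatakeParamAt v α →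
      Multiset.card (E₁ v α) = n ∧ (0 : PadicAlgCl p) ∉ E₁ v α := fun {v α} hα ↦
    ⟨by rw [HarrisLanTaylorThorne2016.card_roots_arithFrobPolyOfSatake, hα.card_eq],
      HarrisLanTaylorThorne2016.zero_not_mem_roots_arithFrobPolyOfSatake ι
        (lt_trans zero_lt_one v.one_lt_residueCard) n (hne hα)⟩
  have hE₁pow : ∀ {v : HeightOneSpectrum (𝓞 K)} {α : Multiset ℂ}, π.HasSatakeParamAt v α →
      ∀ d : ℤ, Multiset.card ((E₁ v α).map (· ^ d)) = n ∧
        (0 : PadicAlgCl p) ∉ (E₁ v α).map (· ^ d) := fun {v α} hα d ↦ by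
    refine ⟨by rw [Multiset.card_map, (hE₁ hα).1], fun h0 ↦ ?_⟩
    obtain ⟨b, hb, hb0⟩ := Multiset.mem_map.mp h0
    exact zpow_ne_zero d (fun hb0' ↦ (hE₁ hα).2 (hb0' ▸ hb)) hb0
  -- the key computation at a Frobenius outside `S`
  have hcompF : ∀ {m : ℤ} (_ : (N₀ : ℤ) ≤ m) {σ : absoluteGaloisGroup K}
      {v : HeightOneSpectrum (𝓞 K)} (_ : v ∉ S) {𝔓 : Ideal (absIntegers (𝓞 K) K)}
      (_ : 𝔓 ∈ v.primesAbove) (_ : IsArithFrobAt (𝓞 K) σ 𝔓) {α : Multiset ℂ}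
      (_ : π.HasSatakeParamAt v α),
      (FramedRep.charpoly (ρ m) (QuotientGroup.mk σ)).roots =
        E₁ v α + (B v).map (· * (((μ (QuotientGroup.mk σ)) ^ m : (PadicAlgCl p)ˣ) :
          PadicAlgCl p)) := by
    intro m hm σ v hv 𝔓 h𝔓 hσ α hα
    rw [hρ_of_le hm, FramedGaloisRep.charpoly_descend_mk,
      (hRv v hv m.toNat (by omega)).2 α hα 𝔓 h𝔓 σ hσ,
      coe_muS_mk_zpow_of_isArithFrobAt p S hSp hv h𝔓 hσ (by omega),
      HarrisLanTaylorThorne2016.arithFrobPolyOfSatake_eq_prod_roots, multiset_prod_X_sub_C_map (B v),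
      ← Multiset.prod_add, ← Multiset.map_add, roots_multiset_prod_X_sub_C]
  -- the key computation at a Frobenius-power element at `T`
  have hcompW : ∀ {m : ℤ} (_ : (N₀ : ℤ) ≤ m) {v : HeightOneSpectrum (𝓞 K)} (_ : v ∈ T)
      {α : Multiset ℂ} (_ : π.HasSatakeParamAt v α) {𝔓 : Ideal (absIntegers (𝓞 K) K)}
      (_ : 𝔓 ∈ v.primesAbove) {φ : absoluteGaloisGroup K} (_ : IsArithFrobAt (𝓞 K) φ 𝔓)
      {d : ℤ} (_ : d ≠ 0) {σ : absoluteGaloisGroup K}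
      (_ : σ * (φ ^ d)⁻¹ ∈ 𝔓.inertia (absoluteGaloisGroup K)),
      (FramedRep.charpoly (ρ m) (QuotientGroup.mk σ)).roots =
        (E₁ v α).map (· ^ d) + (E₂ v 𝔓 φ d σ).map
          (· * (((μ (QuotientGroup.mk σ)) ^ m : (PadicAlgCl p)ˣ) : PadicAlgCl p)) := by
    intro m hm v hv α hα 𝔓 h𝔓 φ hφ d hd σ hσ
    rw [hρ_of_le hm, FramedGaloisRep.charpoly_descend_mk,
      hRT v hv α hα 𝔓 h𝔓 φ hφ d hd σ hσ m.toNat (by omega),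
      coe_muS_mk_zpow_of_frobPow p S hSp (hTp v hv) h𝔓 hφ hσ m,
      show ((m.toNat : ℕ) : ℤ) = m by omega]
  -- witnesses: every `f ∈ 𝔉` has SOME pair of root multisets for the whole family
  have hwit : ∀ f ∈ 𝔉, ∃ D : Multiset (PadicAlgCl p) × Multiset (PadicAlgCl p),
      (Multiset.card D.1 = n ∧ Multiset.card D.2 = n ∧
        (0 : PadicAlgCl p) ∉ D.1 ∧ (0 : PadicAlgCl p) ∉ D.2) ∧
      ∀ m : ℤ, (N₀ : ℤ) ≤ m → (FramedRep.charpoly (ρ m) f).roots =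
        D.1 + D.2.map (· * (((μ f) ^ m : (PadicAlgCl p)ˣ) : PadicAlgCl p)) := by
    rintro _ ⟨σ, hσ, rfl⟩
    rcases hσ with ⟨v, hv, 𝔓, h𝔓, hσ⟩ | ⟨v, hv, 𝔓, h𝔓, φ, hφ, d, hd, hσ⟩
    · obtain ⟨α, hα⟩ := hSat v hv
      exact ⟨(E₁ v α, B v), ⟨(hE₁ hα).1, (hB v hv).1, (hE₁ hα).2, (hB v hv).2⟩,
        fun m hm ↦ hcompF hm hv h𝔓 hσ hα⟩
    · obtain ⟨α, hα⟩ := hTsat v hv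
      exact ⟨((E₁ v α).map (· ^ d), E₂ v 𝔓 φ d σ), ⟨(hE₁pow hα d).1, (hE₂ v 𝔓 φ d σ).1,
        (hE₁pow hα d).2, (hE₂ v 𝔓 φ d σ).2⟩, fun m hm ↦ hcompW hm hv hα h𝔓 hφ hd hσ⟩
  choose! D hD hDρ using hwit
  let 𝔈₁ : GammaS K S → Multiset (PadicAlgCl p) := fun f ↦ (D f).1
  let 𝔈₂ : GammaS K S → Multiset (PadicAlgCl p) := fun f ↦ (D f).2
  have h𝔈 : ∀ f ∈ 𝔉, Multiset.card (𝔈₁ f) = n ∧ Multiset.card (𝔈₂ f) = n ∧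
      (0 : PadicAlgCl p) ∉ 𝔈₁ f ∧ (0 : PadicAlgCl p) ∉ 𝔈₂ f := fun f hf ↦ hD f hf
  -- infinite order of `μ` on `𝔉`
  have hμord : ∀ f ∈ 𝔉, ¬ IsOfFinOrder (μ f) := by
    rintro _ ⟨σ, hσ, rfl⟩
    rcases hσ with ⟨v, hv, 𝔓, h𝔓, hσ⟩ | ⟨v, hv, 𝔓, h𝔓, φ, hφ, d, hd, hσ⟩
    · exact not_isOfFinOrder_muS_mk p S hSp hv h𝔓 hσ
    · exact not_isOfFinOrder_muS_mk_of_frobPow p S hSp (hTp v hv) h𝔓 hφ hd hσ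
  -- the infinite set of exponents `ℳ = [N₀, ∞)`
  let ℳ : Set ℤ := Set.Ici (N₀ : ℤ)
  have hℳ : ℳ.Infinite := Set.Ici_infinite _
  have hss : ∀ m ∈ ℳ, (ρ m).toContinuousRep.IsSemisimple := by
    intro m hm
    have hm' : (N₀ : ℤ) ≤ m := hm
    rw [hρ_of_le hm', ← FramedRep.isSemisimple_inflate_iff, FramedGaloisRep.inflate_descend]
    exact hRss _ (by omega)
  have hρ : ∀ m ∈ ℳ, ∀ f ∈ 𝔉, (FramedRep.charpoly (ρ m) f).roots =
      𝔈₁ f + (𝔈₂ f).map (· * (((μ f) ^ m : (PadicAlgCl p)ˣ) : PadicAlgCl p)) :=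
    fun m hm f hf ↦ hDρ f hf m hm
  -- Prop. 7.12 / Prop. 9.1
  obtain ⟨ρ₁, hρ₁ss, hρ₁⟩ := h712.exists_fst h𝔉 hn μ hμord 𝔈₁ 𝔈₂ h𝔈 hℳ ρ hss hρ
  -- `r := ρ¹ ∘ (Γ_K → Γ_{K,S})`
  refine ⟨ρ₁.inflate, (FramedRep.isSemisimple_inflate_iff ρ₁).mpr hρ₁ss, ?_, ?_⟩
  · -- HLTT's conclusion at the Frobenii outside `S`
    intro v hv
    refine ⟨ρ₁.inflate_isUnramifiedAt hv, ?_⟩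
    intro α hα 𝔓 h𝔓 σ hσ
    have hf : (QuotientGroup.mk σ : GammaS K S) ∈ 𝔉 := ⟨σ, Or.inl ⟨v, hv, 𝔓, h𝔓, hσ⟩, rfl⟩
    -- `𝔈¹_{Frob} = E₁ v α`: independence of the chosen witness (Cor. 7.3)
    have hE : 𝔈₁ (QuotientGroup.mk σ) = E₁ v α := by
      set f : GammaS K S := QuotientGroup.mk σ with hf_def
      refine (twistedSum_unique (hμord f hf) hℳ (h𝔈 f hf).2.2.2 (hB v hv).2 fun m hm ↦ ?_).1
      have hm' : (N₀ : ℤ) ≤ m := hm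
      rw [← hρ m hm f hf]
      exact hcompF hm' hv h𝔓 hσ hα
    have hmonic : (FramedRep.charpoly ρ₁ (QuotientGroup.mk σ : GammaS K S)).Monic :=
      Matrix.charpoly_monic _
    rw [FramedRep.charpoly_inflate, eq_prod_roots_of_monic hmonic, hρ₁ _ hf, hE]
    exact (HarrisLanTaylorThorne2016.arithFrobPolyOfSatake_eq_prod_roots ι _ n α).symm
  · -- Varma's conclusion at the Frobenius-power elements at `T`
    intro v hv α hα 𝔓 h𝔓 φ hφ d hd σ hσ
    have hf : (QuotientGroup.mk σ : GammaS K S) ∈ 𝔉 :=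
      ⟨σ, Or.inr ⟨v, hv, 𝔓, h𝔓, φ, hφ, d, hd, hσ⟩, rfl⟩
    have hE : 𝔈₁ (QuotientGroup.mk σ) = (E₁ v α).map (· ^ d) := by
      set f : GammaS K S := QuotientGroup.mk σ with hf_def
      refine (twistedSum_unique (hμord f hf) hℳ (h𝔈 f hf).2.2.2 (hE₂ v 𝔓 φ d σ).2
        fun m hm ↦ ?_).1
      have hm' : (N₀ : ℤ) ≤ m := hm
      rw [← hρ m hm f hf]
      exact hcompW hm' hv hα h𝔓 hφ hd hσ
    rw [FramedRep.charpoly_inflate, hρ₁ _ hf, hE]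

end Varma2024

end Literature.NumberTheory.Automorphic

end
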